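import Summits.AtomisticToContinuum.BoseEinsteinCondensation.Theorems.BECStronglyRayleighLatticeCoherenceAssemblyGroundSpace
import Summits.AtomisticToContinuum.BoseEinsteinCondensation.Theorems.BECStronglyRayleighLatticeCoherenceAssemblyLowerNorm
import Summits.AtomisticToContinuum.BoseEinsteinCondensation.Theorems.BECStronglyRayleighLatticeCoherenceAssemblyOneParticle
import Literature.Probability.LatticeModels.BackboneCurrent
import HarnessLib

/-!
# `LatticeCoherenceAssembly` (item stmt-AtomisticToContinuum-9680, route BECStronglyRayleigh):
# the layer-2 glue `GroundStateStability → StableImpliesPairCoherence → InsertionFieldDelocalisation →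
# PairKernelSumRule → SectorGroundStatePerron → PenaltySelectsSector → KineticLatticeBEC`

For `L ≥ L₀ = 3` and `1 ≤ N ≤ L³/2` take the Perron vector `ψ` of the sector `S³_tot = N - L³/2` of
`xyTorus 3 L 1` (`SectorGroundStatePerron`).

* `groundState_penalised` (file `…GroundSpace`): `PenaltySelectsSector` + the sector variational
  principle + Perron uniqueness identify the ground space of the penalised Hamiltonian
  `xyTorus 3 L 1 + 4L³(S³_tot + L³/2 - N)²` with `ℂψ`, so its tracial ground-state functional is the
  vector state of `ψ`;
* `re_inner_planar_add` (file `…LowerNorm`): `⟨ψ, ((Ŝˣ)²+(Ŝʸ)²)ψ⟩ + (N - L³/2)‖ψ‖² = ‖Ŝ⁻_tot ψ‖²`;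
* `coherence_bound` (this file): `N·L³·‖ψ‖² ≤ max(M,1)·‖Ŝ⁻_tot ψ‖²`. For `N ≥ 2`: Theorem S
  (`GroundStateStability`, torus graph connected, `Δ = 0`, `μ = 0`) makes the occupation polynomial
  of `φ = Re ψ(1_·) ≥ 0` (supported on `N`-sets) stable; `StableImpliesPairCoherence`,
  `InsertionFieldDelocalisation` (constant `M`) and `PairKernelSumRule` give
  `N(N-1)L³Σφ² ≤ L³Σ_T‖r^T‖²Φ_T ≤ MΣ_T‖r^T‖² = M(N-1)Σ_{x,y}γ(x,y)`, and `Σ_{x,y}γ = ‖Ŝ⁻ψ‖²`,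
  `Σφ² = ‖ψ‖²` (file `…LowerNorm`). For `N = 1`: one free particle, `‖Ŝ⁻ψ‖² = L³‖ψ‖²`
  (file `…OneParticle`).

Hence `KineticLatticeBEC` with `c = 1/max(M,1)`, `L₀ = 3` (`latticeCoherenceAssembly`, alias
`LatticeCoherenceAssembly_proof`).
-/

noncomputable section

namespace Summit.AtomisticToContinuum.BoseEinsteinCondensation.Theorems.LatticeCoherence

open scoped BigOperators Matrix ComplexOrder
open Literature.MathematicalPhysics.QuantumLattice Literature.Probability.LatticeModels Matrix Finset
  Complex
open Summit.AtomisticToContinuum.BoseEinsteinCondensation.Theses.BECStronglyRayleigh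
open Summit.AtomisticToContinuum.BoseEinsteinCondensation.Theorems.InsertionFieldDelocalisation.Negative

/-- The discrete torus `(ℤ/Lℤ)^d` (`L ≠ 0`) is connected: every site is the projection of a point
of `ℤ^d`, and projected lattice paths connect any two projections. [folklore] -/
theorem torusGraph_connected (d L : ℕ) [NeZero L] : (torusGraph d L).Connected := by
  haveI : Nonempty (TorusSite d L) := ⟨fun _ => 0⟩
  rw [SimpleGraph.connected_iff]
  refine ⟨fun x y => ?_, inferInstance⟩
  have hx : Torus.proj L (fun i => ((x i).cast : ℤ)) = x := by
    funext i
    simp [Torus.proj]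
  have hy : Torus.proj L (fun i => ((y i).cast : ℤ)) = y := by
    funext i
    simp [Torus.proj]
  have h := torusGraph_reachable_proj L (fun i => ((x i).cast : ℤ)) (fun i => ((y i).cast : ℤ))
  rwa [hx, hy] at h

/-- **The coherence bound** `N · L³ · ‖ψ‖² ≤ max(M,1) · ‖Ŝ⁻_tot ψ‖²` for the Perron vector `ψ` of the
sector `N - L³/2` of `xyTorus 3 L 1`, `L ≥ 3`, `1 ≤ N ≤ L³/2`, from Theorem S
(`GroundStateStability`), the geometry-of-polynomials glue (`StableImpliesPairCoherence`), the
insertion-field delocalisation constant `M` and the pair-kernel sum rule; `N = 1` is one free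
particle (`oneParticle_norm_lower`). [folklore] -/
theorem coherence_bound (hS : GroundStateStability) (hC : StableImpliesPairCoherence) {M : ℝ}
    (hM : ∀ (L : ℕ) [NeZero L], 2 ≤ L → ∀ N : ℕ, 2 ≤ N → 2 * N ≤ L ^ 3 →
      ∀ ψ : TensorIndex (TorusSite 3 L) 2 → ℂ,
        ψ ∈ spinZSector 1 ((N : ℝ) - (L : ℝ) ^ 3 / 2) → ψ ≠ 0 →
        (xyTorus 3 L 1).mulVec ψ =
          ((lowestEnergyInSector 1 (xyTorus 3 L 1) ((N : ℝ) - (L : ℝ) ^ 3 / 2) : ℝ) : ℂ) • ψ →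
        (∀ σ, 0 ≤ (ψ σ).re ∧ (ψ σ).im = 0) →
        let φ : Finset (TorusSite 3 L) → ℝ := fun S => (ψ (fun x => if x ∈ S then 0 else 1)).re
        let r : Finset (TorusSite 3 L) → TorusSite 3 L → ℝ := fun T x =>
          ∑ y, (if x ∉ T ∧ y ∉ T ∧ x ≠ y then φ (insert x (insert y T)) else 0)
        (L : ℝ) ^ 3 * ∑ T ∈ (Finset.univ : Finset (TorusSite 3 L)).powersetCard (N - 2),
            ((∑ x, r T x ^ 3) / (∑ x, r T x) + (∑ x, r T x ^ 2) ^ 2 / (∑ x, r T x) ^ 2) ≤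
          M * ∑ T ∈ (Finset.univ : Finset (TorusSite 3 L)).powersetCard (N - 2), ∑ x, r T x ^ 2)
    (hK : PairKernelSumRule) (L : ℕ) [NeZero L] (hL : 3 ≤ L) (N : ℕ) (hN1 : 1 ≤ N)
    (hNL : 2 * N ≤ L ^ 3) (ψ : TensorIndex (TorusSite 3 L) 2 → ℂ) (hψ0 : ψ ≠ 0)
    (hψnn : ∀ σ, 0 ≤ (ψ σ).re ∧ (ψ σ).im = 0)
    (hψsec : ψ ∈ spinZSector 1 ((N : ℝ) - (L : ℝ) ^ 3 / 2))
    (hHψ : (xyTorus 3 L 1) *ᵥ ψ =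
      ((lowestEnergyInSector 1 (xyTorus 3 L 1) ((N : ℝ) - (L : ℝ) ^ 3 / 2) : ℝ) : ℂ) • ψ)
    (huniq : ∀ ψ' : TensorIndex (TorusSite 3 L) 2 → ℂ,
      ψ' ∈ spinZSector 1 ((N : ℝ) - (L : ℝ) ^ 3 / 2) →
      (xyTorus 3 L 1) *ᵥ ψ' =
        ((lowestEnergyInSector 1 (xyTorus 3 L 1) ((N : ℝ) - (L : ℝ) ^ 3 / 2) : ℝ) : ℂ) • ψ' →
      ∃ c : ℂ, ψ' = c • ψ) :
    (N : ℝ) * (L : ℝ) ^ 3 * (star ψ ⬝ᵥ ψ).re ≤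
      max M 1 * (star ((totalSpin 1 0 - I • totalSpin 1 1 : Op (TorusSite 3 L) 2) *ᵥ ψ) ⬝ᵥ
        ((totalSpin 1 0 - I • totalSpin 1 1 : Op (TorusSite 3 L) 2) *ᵥ ψ)).re := by
  set Sm : Op (TorusSite 3 L) 2 := totalSpin 1 0 - I • totalSpin 1 1 with hSm
  set Q : ℝ := (star (Sm *ᵥ ψ) ⬝ᵥ (Sm *ᵥ ψ)).re with hQ
  set B : ℝ := (star ψ ⬝ᵥ ψ).re with hB
  have hQnn : 0 ≤ Q := EigenvalueContinuation.re_star_dotProduct_self_nonneg _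
  have hBnn : 0 ≤ B := EigenvalueContinuation.re_star_dotProduct_self_nonneg _
  have hmax1 : (1 : ℝ) ≤ max M 1 := le_max_right _ _
  have hmaxM : M ≤ max M 1 := le_max_left _ _
  have hL2 : 2 ≤ L := by omega
  by_cases hN2 : 2 ≤ N
  · -- `N ≥ 2`: stability ⟹ pair coherence ⟹ delocalisation ⟹ sum rule
    have hcard := InsertionFieldDelocalisation.Negative.card_torusSite 3 L
    have hreal : ∀ σ, (ψ σ).im = 0 := fun σ => (hψnn σ).2
    set φ : Finset (TorusSite 3 L) → ℝ := fun S => (ψ (fun x => if x ∈ S then 0 else 1)).re with hφdef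
    have hφ : ∀ S, φ S = (ψ (fun x => if x ∈ S then 0 else 1)).re := fun S => rfl
    have hφnn : ∀ S, 0 ≤ φ S := fun S => (hψnn _).1
    have hφsupp : ∀ S : Finset (TorusSite 3 L), S.card ≠ N → φ S = 0 := by
      intro S hS
      rw [hφ, apply_ind_eq_zero_of_card_ne N (by rw [hcard]; push_cast; ring) hψsec S hS,
        Complex.zero_re]
    -- Theorem S on the torus graph, `Δ = 0`, `μ = 0`
    have hstab : ∀ z : TorusSite 3 L → ℂ, (∀ x, 0 < (z x).im) →
        (∑ S : Finset (TorusSite 3 L), (φ S : ℂ) * ∏ x ∈ S, z x) ≠ 0 := by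
      intro z hz
      have h := hS (TorusSite 3 L) (torusGraph 3 L) (torusGraph_connected 3 L) 0 (fun _ => 0)
        (by norm_num) ((N : ℝ) - (L : ℝ) ^ 3 / 2) ψ hψsec hψ0
      simp only [Complex.ofReal_zero, zero_smul, Finset.sum_const_zero, add_zero] at h
      rw [← occPoly_eq ψ hreal φ hφ z]
      exact h hHψ z hz
    set r : Finset (TorusSite 3 L) → TorusSite 3 L → ℝ := fun T x =>
      ∑ y, (if x ∉ T ∧ y ∉ T ∧ x ≠ y then φ (insert x (insert y T)) else 0) with hrdef
    have h1 : (N : ℝ) * ((N : ℝ) - 1) * ∑ S : Finset (TorusSite 3 L), φ S ^ 2 ≤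
        ∑ T ∈ (Finset.univ : Finset (TorusSite 3 L)).powersetCard (N - 2),
          ((∑ x, r T x ^ 3) / (∑ x, r T x) + (∑ x, r T x ^ 2) ^ 2 / (∑ x, r T x) ^ 2) :=
      hC (TorusSite 3 L) N hN2 φ hφnn hφsupp hstab
    have h2 : (L : ℝ) ^ 3 * ∑ T ∈ (Finset.univ : Finset (TorusSite 3 L)).powersetCard (N - 2),
          ((∑ x, r T x ^ 3) / (∑ x, r T x) + (∑ x, r T x ^ 2) ^ 2 / (∑ x, r T x) ^ 2) ≤
        M * ∑ T ∈ (Finset.univ : Finset (TorusSite 3 L)).powersetCard (N - 2), ∑ x, r T x ^ 2 :=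
      hM L hL2 N hN2 hNL ψ hψsec hψ0 hHψ hψnn
    have h3 : ∑ T ∈ (Finset.univ : Finset (TorusSite 3 L)).powersetCard (N - 2), ∑ x, r T x ^ 2 =
        ((N : ℝ) - 1) * ∑ x : TorusSite 3 L, ∑ y : TorusSite 3 L,
          (if x = y then ∑ S : Finset (TorusSite 3 L), (if x ∈ S then φ S ^ 2 else 0)
            else ∑ T ∈ (Finset.univ : Finset (TorusSite 3 L)).powersetCard (N - 1),
              (if x ∉ T ∧ y ∉ T then φ (insert x T) * φ (insert y T) else 0)) :=
      hK (TorusSite 3 L) N hN2 φ hφsupp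
    have h4 : (∑ x : TorusSite 3 L, ∑ y : TorusSite 3 L,
          (if x = y then ∑ S : Finset (TorusSite 3 L), (if x ∈ S then φ S ^ 2 else 0)
            else ∑ T ∈ (Finset.univ : Finset (TorusSite 3 L)).powersetCard (N - 1),
              (if x ∉ T ∧ y ∉ T then φ (insert x T) * φ (insert y T) else 0))) = Q :=
      (re_norm_lower_eq_pairSum N ψ hreal φ hφ hφsupp).symm
    have h5 : B = ∑ S : Finset (TorusSite 3 L), φ S ^ 2 := re_norm_eq_sum_sq ψ hreal φ hφ
    have hpos : (0 : ℝ) < (N : ℝ) - 1 := by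
      have : (2 : ℝ) ≤ N := by exact_mod_cast hN2
      linarith
    have hA : ((N : ℝ) - 1) * ((N : ℝ) * (L : ℝ) ^ 3 * B) ≤ ((N : ℝ) - 1) * (M * Q) := by
      have e1 : ((N : ℝ) - 1) * ((N : ℝ) * (L : ℝ) ^ 3 * B) =
          (L : ℝ) ^ 3 * ((N : ℝ) * ((N : ℝ) - 1) * ∑ S : Finset (TorusSite 3 L), φ S ^ 2) := by
        rw [h5]
        ring
      rw [e1]
      calc (L : ℝ) ^ 3 * ((N : ℝ) * ((N : ℝ) - 1) * ∑ S : Finset (TorusSite 3 L), φ S ^ 2)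
          ≤ (L : ℝ) ^ 3 * ∑ T ∈ (Finset.univ : Finset (TorusSite 3 L)).powersetCard (N - 2),
              ((∑ x, r T x ^ 3) / (∑ x, r T x) + (∑ x, r T x ^ 2) ^ 2 / (∑ x, r T x) ^ 2) :=
            mul_le_mul_of_nonneg_left h1 (by positivity)
        _ ≤ M * ∑ T ∈ (Finset.univ : Finset (TorusSite 3 L)).powersetCard (N - 2), ∑ x, r T x ^ 2 :=
            h2
        _ = ((N : ℝ) - 1) * (M * Q) := by rw [h3, h4]; ring
    have hB' : (N : ℝ) * (L : ℝ) ^ 3 * B ≤ M * Q := le_of_mul_le_mul_left hA hpos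
    calc (N : ℝ) * (L : ℝ) ^ 3 * B ≤ M * Q := hB'
      _ ≤ max M 1 * Q := mul_le_mul_of_nonneg_right hmaxM hQnn
  · -- `N = 1`: one free particle
    have hN : N = 1 := by omega
    subst hN
    have hone := oneParticle_norm_lower 3 L hL ψ hψ0 hψnn hψsec hHψ huniq
    have hone' : Q = (L : ℝ) ^ 3 * B := by
      rw [hQ, hB, hSm]
      exact hone
    calc ((1 : ℕ) : ℝ) * (L : ℝ) ^ 3 * B = Q := by rw [hone']; push_cast; ring
      _ ≤ max M 1 * Q := le_mul_of_one_le_left hQnn hmax1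

/-- **`LatticeCoherenceAssembly` (item stmt-AtomisticToContinuum-9680).** The layer-2 glue of route
BECStronglyRayleigh: `GroundStateStability → StableImpliesPairCoherence →
InsertionFieldDelocalisation → PairKernelSumRule → SectorGroundStatePerron → PenaltySelectsSector →
KineticLatticeBEC`, with `c = 1/max(M,1)` and `L₀ = 3`. For `L ≥ 3` and `1 ≤ N ≤ L³/2`: the Perron
vector `ψ` of the sector spans the ground space of the penalised Hamiltonian, whose ground-state
functional is the vector state of `ψ` (`groundState_penalised`);
`⟨(Ŝˣ)²+(Ŝʸ)²⟩_ψ + N - L³/2 = ‖Ŝ⁻ψ‖²/‖ψ‖²` (`re_inner_planar_add`); and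
`N·L³·‖ψ‖² ≤ max(M,1)·‖Ŝ⁻ψ‖²` (`coherence_bound`). [folklore] -/
theorem latticeCoherenceAssembly : LatticeCoherenceAssembly := by
  intro hS hC hI hK hP hPen
  obtain ⟨M, hM⟩ := hI
  refine ⟨1 / max M 1, by positivity, 3, ?_⟩
  intro L _ hL _hLeven N hN1 hNL
  have hL2 : 2 ≤ L := by omega
  have hNle : N ≤ L ^ 3 := by omega
  obtain ⟨ψ, hψ0, hψnn, hψsec, hHψ, huniq, hgs⟩ :=
    groundState_penalised hP hPen 3 L N (by norm_num) hL2 hNle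
  rw [hgs]
  set Sm : Op (TorusSite 3 L) 2 := totalSpin 1 0 - I • totalSpin 1 1 with hSm
  set Q : ℝ := (star (Sm *ᵥ ψ) ⬝ᵥ (Sm *ᵥ ψ)).re with hQ
  set B : ℝ := (star ψ ⬝ᵥ ψ).re with hB
  set A : ℝ := (star ψ ⬝ᵥ
    (totalSpin 1 0 * totalSpin 1 0 + totalSpin 1 1 * totalSpin 1 1 : Op (TorusSite 3 L) 2) *ᵥ ψ).re
    with hA
  have hBpos : 0 < B := EigenvalueContinuation.re_star_dotProduct_self_pos hψ0
  have hBc : star ψ ⬝ᵥ ψ = (B : ℂ) :=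
    Complex.ext rfl (EigenvalueContinuation.im_star_dotProduct_self ψ)
  have hplanar : A + ((N : ℝ) - (L : ℝ) ^ 3 / 2) * B = Q :=
    re_inner_planar_add ((N : ℝ) - (L : ℝ) ^ 3 / 2) ψ hψsec
  have hkey : (N : ℝ) * (L : ℝ) ^ 3 * B ≤ max M 1 * Q :=
    coherence_bound hS hC hM hK L hL N hN1 hNL ψ hψ0 hψnn hψsec hHψ huniq
  have hmaxpos : 0 < max M 1 := lt_of_lt_of_le one_pos (le_max_right _ _)
  have hB0 : B ≠ 0 := hBpos.ne'
  rw [hBc, Complex.div_ofReal_re]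
  have hgoal : 1 / max M 1 * (N : ℝ) * (L : ℝ) ^ 3 ≤ (A + ((N : ℝ) - (L : ℝ) ^ 3 / 2) * B) / B := by
    rw [hplanar, le_div_iff₀ hBpos]
    calc 1 / max M 1 * (N : ℝ) * (L : ℝ) ^ 3 * B = ((N : ℝ) * (L : ℝ) ^ 3 * B) / max M 1 := by ring
      _ ≤ (max M 1 * Q) / max M 1 := div_le_div_of_nonneg_right hkey hmaxpos.le
      _ = Q := by field_simp
  calc 1 / max M 1 * (N : ℝ) * (L : ℝ) ^ 3 ≤ (A + ((N : ℝ) - (L : ℝ) ^ 3 / 2) * B) / B := hgoal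
    _ = A / B + N - (L : ℝ) ^ 3 / 2 := by
        field_simp
        ring

end Summit.AtomisticToContinuum.BoseEinsteinCondensation.Theorems.LatticeCoherence

/-- **`LatticeCoherenceAssembly`** — `Theorems`-namespace alias of
`LatticeCoherence.latticeCoherenceAssembly`, closing item stmt-AtomisticToContinuum-9680 of route
BECStronglyRayleigh: the layer-2 glue `GroundStateStability → StableImpliesPairCoherence →
InsertionFieldDelocalisation → PairKernelSumRule → SectorGroundStatePerron → PenaltySelectsSector →
KineticLatticeBEC`. [folklore] -/
theorem Summit.AtomisticToContinuum.BoseEinsteinCondensation.Theorems.LatticeCoherenceAssembly_proof :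
    Summit.AtomisticToContinuum.BoseEinsteinCondensation.Theses.BECStronglyRayleigh.LatticeCoherenceAssembly :=
  Summit.AtomisticToContinuum.BoseEinsteinCondensation.Theorems.LatticeCoherence.latticeCoherenceAssembly
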